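import Literature.MeasureTheory.Group.InvariantQuotientPi
import Literature.MeasureTheory.Group.InvariantQuotientNormalized
import HarnessLib

/-!
# The quotient measure of a finite product is the product of the quotient measures:
# `(⨂ ν_i)/(⨂ ρ_i) = ⊠ (ν_i/ρ_i)` on `(Π G_i) ⧸ (Π H_i) = Π (G_i ⧸ H_i)`
(Folland, *A Course in Abstract Harmonic Analysis* (1995), §2.6, Thm. 2.49 / (2.52); Bump (1997),
Prop. 3.3.2: product Haar measures; the normalisation behind the product `Π_{v ∈ S}` in Gelbart's
(10.19))

Topic `MeasureTheory/Group`; namespace `Literature.MeasureTheory.Group`. Two small definitions with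
bodies (`subgroupPiCoords`, `subgroupPiHomeomorph`: the coordinates `Π H_i ≤ Π G_i → Π_i ↥H_i`, a
homeomorphism) and theorems; no named fact, no instance. The finite-product analogue of
`InvariantQuotientProdNormalized`: `InvariantQuotientPi` shows that an invariant measure on
`(Π G_i) ⧸ (Π H_i)` is `c • ⊠ μ_i` for SOME `c ≠ 0`; for the canonical quotient measures
`ν/ρ = quotientMeasure` of product Haar measures — `Measure.pi ν` on `Π G_i`, `ρ ↔ Measure.pi ρ_i` on
`Π H_i` — the constant is `1`:

* `lintegral_pi_prod_ofReal_eq_prod` — `∫⁻ Π_i φ_i(x_i) d(⨂ μ_i) = Π_i ∫⁻ φ_i dμ_i` for integrable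
  `φ_i ≥ 0` (through Mathlib's Bochner `integral_fintype_prod_eq_prod`);
* `fiberLIntegral_pi_prod_eq` — fibre integrals of `⊗ g_i` (`g_i ∈ C_c(G_i)`, `g_i ≥ 0`) along
  `Π H_i` factor: `(⊗ g_i)^{Π H_i}((a_i)(Π H_i)) = Π_i g_i^{H_i}(a_i H_i)`;
* `map_quotientPiHomeomorph_symm_pi_quotientMeasure_eq` / `map_quotientPiHomeomorph_quotientMeasure_pi`
  — **`(⨂ ν_i)/(⨂ ρ_i) = ⊠ (ν_i/ρ_i)`** (the transported product is invariant and finite on compact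
  sets, hence `c •` the quotient measure with `c` its unfolding constant; Weil's formula on `⊗ g_i`,
  the factorisations above and Weil with constant `1` on each factor give `c Π ∫ g_i = Π ∫ g_i`);
* `lintegral_quotientMeasure_pi_eq`, `integral_quotientMeasure_pi_eq_integral_pi`,
  `integral_quotientMeasure_pi_prod_eq_prod` — the constant-free Fubini formulas, e.g.
  `∫ ⊗ f_i d((⨂ν_i)/(⨂ρ_i)) = Π_i ∫ f_i d(ν_i/ρ_i)`.

Part of the inline (D-0026) decomposition of
`Literature.NumberTheory.Automorphic.strong_multiplicity_one_quaternionUnits` (Gelbart (10.19): the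
product over the places of `S` with its equality sign).

## References

* G. B. Folland, *A Course in Abstract Harmonic Analysis* (1995), §2.6, Thm. 2.49, (2.52) [Folland1995].
* D. Bump, *Automorphic Forms and Representations* (1997), §3.3, Prop. 3.3.2 [Bump1997].
* S. Gelbart, *Automorphic forms on adele groups*, Ann. of Math. Studies 83 (1975), §10, p. 155,
  (10.19) [Gelbart1975].
-/

noncomputable section

open MeasureTheory MeasureTheory.Measure Topology Filter
open scoped NNReal ENNReal

namespace Literature.MeasureTheory.Group

/-! ### A Tonelli formula for products of non-negative integrable factors -/

section Tonelli

variable {ι : Type*} [Fintype ι] {X : ι → Type*} [∀ i, MeasurableSpace (X i)] (μ : ∀ i, Measure (X i))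
  [∀ i, SigmaFinite (μ i)]

omit [Fintype ι] in
/-- **Tonelli in `n` variables for `[0, ∞]`-valued measurable factors**:
`∫⁻ Π_i f_i(x_i) d(⨂ μ_i) = Π_i ∫⁻ f_i dμ_i` over `Fin n` (induction, splitting off the first
coordinate with Mathlib's `measurePreserving_piFinSuccAbove`; the Bochner version is Mathlib's
`integral_fin_nat_prod_eq_prod`). [folklore] -/
theorem lintegral_fin_nat_prod_eq_prod {n : ℕ} {E : Fin n → Type*} [∀ i, MeasurableSpace (E i)]
    (μ : ∀ i, Measure (E i)) [∀ i, SigmaFinite (μ i)] {f : ∀ i, E i → ℝ≥0∞} (hf : ∀ i, Measurable (f i)) :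
    ∫⁻ x, ∏ i, f i (x i) ∂Measure.pi μ = ∏ i, ∫⁻ y, f i y ∂μ i := by
  induction n with
  | zero =>
    simp only [Finset.univ_eq_empty, Finset.prod_empty, lintegral_const, one_mul]
    exact Measure.pi_empty_univ μ
  | succ n ih =>
    have hmp := (measurePreserving_piFinSuccAbove μ 0).symm
    rw [← hmp.lintegral_comp_emb (MeasurableEquiv.measurableEmbedding _)]
    have h1 : ∀ a : E 0 × (∀ j : Fin n, E (Fin.succAbove 0 j)),
        ∏ i, f i ((MeasurableEquiv.piFinSuccAbove E 0).symm a i) =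
          f 0 a.1 * ∏ j : Fin n, f (Fin.succAbove 0 j) (a.2 j) := by
      intro a
      rw [Fin.prod_univ_succAbove _ 0]
      simp only [MeasurableEquiv.piFinSuccAbove_symm_apply, Fin.insertNthEquiv, Equiv.coe_fn_mk,
        Fin.insertNth_apply_same, Fin.insertNth_apply_succAbove]
    simp_rw [h1]
    have hg : Measurable fun z : (∀ j : Fin n, E (Fin.succAbove 0 j)) => ∏ j, f (Fin.succAbove 0 j) (z j) :=
      Finset.measurable_prod _ fun j _ => (hf (Fin.succAbove 0 j)).comp (measurable_pi_apply j)
    rw [lintegral_prod_mul (μ := μ 0) (ν := Measure.pi fun j => μ (Fin.succAbove 0 j)) (f := f 0)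
        (g := fun z : (∀ j : Fin n, E (Fin.succAbove 0 j)) => ∏ j, f (Fin.succAbove 0 j) (z j))
        (hf 0).aemeasurable hg.aemeasurable,
      ih (fun j => μ (Fin.succAbove 0 j)) (fun j => hf (Fin.succAbove 0 j)), Fin.prod_univ_succAbove _ 0]

/-- **Tonelli for `[0, ∞]`-valued measurable factors indexed by a finite type**:
`∫⁻ Π_i f_i(x_i) d(⨂ μ_i) = Π_i ∫⁻ f_i dμ_i`. [folklore] -/
theorem lintegral_fintype_prod_eq_prod {f : ∀ i, X i → ℝ≥0∞} (hf : ∀ i, Measurable (f i)) :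
    ∫⁻ x, ∏ i, f i (x i) ∂Measure.pi μ = ∏ i, ∫⁻ y, f i y ∂μ i := by
  let e := (Fintype.equivFin ι).symm
  rw [← (measurePreserving_piCongrLeft μ e).lintegral_comp_emb (MeasurableEquiv.measurableEmbedding _)]
  have h1 : ∀ x : ∀ k : Fin (Fintype.card ι), X (e k),
      ∏ i, f i (MeasurableEquiv.piCongrLeft X e x i) = ∏ k, f (e k) (x k) := by
    intro x
    rw [← e.prod_comp]
    refine Finset.prod_congr rfl fun k _ => ?_
    rw [MeasurableEquiv.coe_piCongrLeft, Equiv.piCongrLeft_apply_apply]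
  simp_rw [h1]
  rw [lintegral_fin_nat_prod_eq_prod (fun k => μ (e k)) (fun k => hf (e k)), ← e.prod_comp]

/-- **`∫⁻ Π_i φ_i(x_i) d(⨂ μ_i) = Π_i ∫⁻ φ_i dμ_i`** for real integrable `φ_i ≥ 0` (read through
`ENNReal.ofReal`; Mathlib's Bochner `integral_fintype_prod_eq_prod`). [folklore] -/
theorem lintegral_pi_prod_ofReal_eq_prod {φ : ∀ i, X i → ℝ} (hφ : ∀ i, Integrable (φ i) (μ i)) (hnn : ∀ i, 0 ≤ φ i) :
    ∫⁻ x, ∏ i, ENNReal.ofReal (φ i (x i)) ∂Measure.pi μ = ∏ i, ∫⁻ y, ENNReal.ofReal (φ i y) ∂μ i := by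
  have h1 : ∀ x : ∀ i, X i, ∏ i, ENNReal.ofReal (φ i (x i)) = ENNReal.ofReal (∏ i, φ i (x i)) := fun x =>
    (ENNReal.ofReal_prod_of_nonneg fun i _ => hnn i (x i)).symm
  simp_rw [h1]
  rw [← ofReal_integral_eq_lintegral_ofReal (Integrable.fintype_prod_dep hφ)
      (Eventually.of_forall fun x => Finset.prod_nonneg fun i _ => hnn i (x i)),
    integral_fintype_prod_eq_prod, ENNReal.ofReal_prod_of_nonneg fun i _ => integral_nonneg (hnn i)]
  exact Finset.prod_congr rfl fun i _ => ofReal_integral_eq_lintegral_ofReal (hφ i) (Eventually.of_forall (hnn i))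

end Tonelli

/-! ### `Π H_i` as a subgroup of `Π G_i` versus the product of the `H_i` -/

section Coords

variable {ι : Type*} {G : ι → Type*} [∀ i, Group (G i)] (H : ∀ i, Subgroup (G i))

/-- `Π H_i` is closed in `Π G_i` when the `H_i` are. [folklore] -/
theorem isClosed_coe_pi [∀ i, TopologicalSpace (G i)] (hH : ∀ i, IsClosed (H i : Set (G i))) :
    IsClosed ((Subgroup.pi Set.univ H : Subgroup (∀ i, G i)) : Set (∀ i, G i)) := by
  have hset : ((Subgroup.pi Set.univ H : Subgroup (∀ i, G i)) : Set (∀ i, G i)) = Set.pi Set.univ fun i => (H i : Set (G i)) := by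
    ext x
    simp [Subgroup.mem_pi]
  rw [hset]
  exact isClosed_set_pi fun i _ => hH i

/-- **The coordinates of an element of `Π H_i ≤ Π G_i`** as an element of the product of the subgroup
types, `h ↦ (h_i)_i`; a group isomorphism `↥(Π H_i) ≃* Π_i ↥H_i`. [folklore] -/
def subgroupPiCoords : (Subgroup.pi Set.univ H) ≃* ∀ i, H i where
  toFun h i := ⟨(h : ∀ i, G i) i, h.2 i (Set.mem_univ i)⟩
  invFun p := ⟨fun i => p i, fun i _ => (p i).2⟩
  left_inv _ := rfl
  right_inv _ := rfl
  map_mul' _ _ := rfl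

/-- The coordinates on underlying elements (definitional). [folklore] -/
@[simp]
theorem coe_subgroupPiCoords_apply (h : Subgroup.pi Set.univ H) (i : ι) :
    ((subgroupPiCoords H h i : H i) : G i) = (h : ∀ i, G i) i := rfl

/-- The inverse on underlying elements (definitional). [folklore] -/
@[simp]
theorem coe_subgroupPiCoords_symm_apply (p : ∀ i, H i) :
    (((subgroupPiCoords H).symm p : Subgroup.pi Set.univ H) : ∀ i, G i) = fun i => (p i : G i) := rfl

/-- **`↥(Π H_i) ≃ₜ Π_i ↥H_i`**: the coordinates are a homeomorphism (product and subspace topologies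
commute). [folklore] -/
def subgroupPiHomeomorph [∀ i, TopologicalSpace (G i)] : (Subgroup.pi Set.univ H) ≃ₜ ∀ i, H i where
  toEquiv := (subgroupPiCoords H).toEquiv
  continuous_toFun := continuous_pi fun i => ((continuous_apply i).comp continuous_subtype_val).subtype_mk _
  continuous_invFun := (continuous_pi fun i => continuous_subtype_val.comp (continuous_apply i)).subtype_mk _

/-- The homeomorphism is the coordinate map (definitional). [folklore] -/
@[simp]
theorem coe_subgroupPiHomeomorph [∀ i, TopologicalSpace (G i)] :
    (subgroupPiHomeomorph H : (Subgroup.pi Set.univ H) → ∀ i, H i) = subgroupPiCoords H := rfl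

end Coords

/-! ### Fibre integrals of product functions along `Π H_i` -/

section Fiber

variable {ι : Type*} [Fintype ι] {G : ι → Type*} [∀ i, Group (G i)] [∀ i, TopologicalSpace (G i)]
  [∀ i, IsTopologicalGroup (G i)] [∀ i, SecondCountableTopology (G i)]
  [∀ i, T2Space (G i)] [∀ i, MeasurableSpace (G i)] [∀ i, BorelSpace (G i)]
  (H : ∀ i, Subgroup (G i)) (hH : ∀ i, IsClosed (H i : Set (G i)))
  (ρi : ∀ i, Measure (H i)) [∀ i, (ρi i).IsMulLeftInvariant] [∀ i, IsFiniteMeasureOnCompacts (ρi i)]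
  [∀ i, SigmaFinite (ρi i)]
  (ρ : Measure (Subgroup.pi Set.univ H)) [ρ.IsMulLeftInvariant]
  (hρ : Measure.map (subgroupPiCoords H) ρ = Measure.pi ρi)

include hH hρ in
/-- **Fibre integrals of product functions along `Π H_i` factor**: for `g_i ∈ C_c(G_i)`, `g_i ≥ 0`
and `ρ ↔ ⨂ ρ_i`, `∫_{Π H_i} Π_i g_i(a_i h_i) dρ(h) = Π_i ∫_{H_i} g_i(a_i h_i) dρ_i(h_i)`.
[cite: Folland1995, §2.6 (2.52)] -/
theorem fiberLIntegral_pi_prod_eq {g : ∀ i, G i → ℝ} (hgc : ∀ i, Continuous (g i))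
    (hgs : ∀ i, HasCompactSupport (g i)) (hg0 : ∀ i, 0 ≤ g i) (a : ∀ i, G i) :
    fiberLIntegral (Subgroup.pi Set.univ H) ρ (fun x : ∀ i, G i => ∏ i, ENNReal.ofReal (g i (x i))) (QuotientGroup.mk a) =
      ∏ i, fiberLIntegral (H i) (ρi i) (fun y => ENNReal.ofReal (g i y)) (QuotientGroup.mk (a i)) := by
  letI : MeasurableSpace (∀ i, G i) := MeasurableSpace.pi
  have hρ' : Measure.map (subgroupPiHomeomorph H).toMeasurableEquiv ρ = Measure.pi ρi := by
    rw [Homeomorph.toMeasurableEquiv_coe, coe_subgroupPiHomeomorph, hρ]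
  rw [fiberLIntegral_mk]
  have h1 : ∫⁻ h : Subgroup.pi Set.univ H, ∏ i, ENNReal.ofReal (g i ((a * (h : ∀ i, G i)) i)) ∂ρ =
      ∫⁻ p : ∀ i, H i, ∏ i, ENNReal.ofReal (g i (a i * (p i : G i))) ∂(Measure.map (subgroupPiHomeomorph H).toMeasurableEquiv ρ) := by
    rw [lintegral_map_equiv]
    rfl
  rw [h1, hρ', lintegral_pi_prod_ofReal_eq_prod ρi (φ := fun i (y : H i) => g i (a i * (y : G i)))
    (fun i => integrable_fiber (H i) (ρi i) (hH i) (hgc i) (hgs i) (a i)) (fun i y => hg0 i _)]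
  exact Finset.prod_congr rfl fun i _ => (fiberLIntegral_mk (H i) (ρi i) (fun y => ENNReal.ofReal (g i y)) (a i)).symm

end Fiber

/-! ### The quotient measure of a finite product -/

section PiNormalized

variable {ι : Type*} [Fintype ι] {G : ι → Type*} [∀ i, Group (G i)] [∀ i, TopologicalSpace (G i)]
  [∀ i, IsTopologicalGroup (G i)] [∀ i, LocallyCompactSpace (G i)] [∀ i, SecondCountableTopology (G i)]
  [∀ i, T2Space (G i)] [∀ i, MeasurableSpace (G i)] [∀ i, BorelSpace (G i)]
  (H : ∀ i, Subgroup (G i)) (hH : ∀ i, IsClosed (H i : Set (G i)))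
  (ρi : ∀ i, Measure (H i)) [∀ i, (ρi i).IsMulLeftInvariant] [∀ i, IsFiniteMeasureOnCompacts (ρi i)]
  [∀ i, (ρi i).IsOpenPosMeasure] [∀ i, (ρi i).IsInvInvariant] [∀ i, SigmaFinite (ρi i)]
  (ρ : Measure (Subgroup.pi Set.univ H)) [ρ.IsMulLeftInvariant] [IsFiniteMeasureOnCompacts ρ] [ρ.IsOpenPosMeasure]
  [ρ.IsInvInvariant] [SFinite ρ]
  (hρ : Measure.map (subgroupPiCoords H) ρ = Measure.pi ρi)
  (ν : ∀ i, Measure (G i)) [∀ i, IsHaarMeasure (ν i)] [∀ i, (ν i).IsMulRightInvariant]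
  [∀ i, MeasurableSpace (G i ⧸ H i)] [∀ i, BorelSpace (G i ⧸ H i)]
  [MeasurableSpace ((∀ i, G i) ⧸ Subgroup.pi Set.univ H)] [BorelSpace ((∀ i, G i) ⧸ Subgroup.pi Set.univ H)]

include hH hρ in
/-- **`(⨂ ν_i)/(⨂ ρ_i) = ⊠ (ν_i/ρ_i)`** — the quotient measure of the product Haar measures by the product
subgroup is the transported product of the quotient measures: with
`e : (Π G_i) ⧸ (Π H_i) ≃ₜ Π (G_i ⧸ H_i)`,
`quotientMeasure (Π H_i) ρ (⨂ ν_i) = (e⁻¹)_* (⨂_i quotientMeasure H_i ρ_i ν_i)`.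
Proof: the right side is invariant and finite on compact sets, so it is `c •` the left side with `c`
its unfolding constant; Weil's formula on `⊗ g_i` (`g_i ∈ C_c(G_i)`, `g_i ≥ 0`, `g_i(1) ≠ 0`) computed
through `fiberLIntegral_pi_prod_eq`, Tonelli and Weil with constant `1` on each factor gives
`c Π ∫ g_i = Π ∫ g_i`, whence `c = 1`. [cite: Folland1995, §2.6 Thm. 2.49, (2.52)] [cite: Bump1997, §3.3 Prop. 3.3.2] -/
theorem map_quotientPiHomeomorph_symm_pi_quotientMeasure_eq :
    Measure.map (quotientPiHomeomorph H).symm (Measure.pi fun i => quotientMeasure (H i) (ρi i) (hH i) (ν i)) =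
      quotientMeasure (Subgroup.pi Set.univ H) ρ (isClosed_coe_pi H hH) (Measure.pi ν) := by
  haveI : IsClosed ((Subgroup.pi Set.univ H : Subgroup (∀ i, G i)) : Set (∀ i, G i)) := isClosed_coe_pi H hH
  haveI : ∀ i, IsClosed (H i : Set (G i)) := hH
  haveI : ∀ i, SecondCountableTopology (G i ⧸ H i) := fun i => inferInstance
  set q : ∀ i, Measure (G i ⧸ H i) := fun i => quotientMeasure (H i) (ρi i) (hH i) (ν i) with hq
  haveI : ∀ i, IsFiniteMeasureOnCompacts (q i) := fun i => inferInstance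
  haveI : ∀ i, SigmaFinite (q i) := fun i => inferInstance
  haveI : ∀ i, SMulInvariantMeasure (G i) (G i ⧸ H i) (q i) := fun i => inferInstance
  set Q := quotientMeasure (Subgroup.pi Set.univ H) ρ (isClosed_coe_pi H hH) (Measure.pi ν) with hQ
  set μ := Measure.map (quotientPiHomeomorph H).symm (Measure.pi q) with hμ
  haveI : SMulInvariantMeasure (∀ i, G i) _ μ := smulInvariantMeasure_map_symm_pi H q
  haveI : IsFiniteMeasureOnCompacts μ := isFiniteMeasureOnCompacts_map_symm_pi H q
  have hμQ : μ = unfoldingConstant (Subgroup.pi Set.univ H) ρ μ (Measure.pi ν) • Q :=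
    eq_unfoldingConstant_smul_quotientMeasure (Subgroup.pi Set.univ H) ρ (Measure.pi ν) μ
  -- test functions `g_i ∈ C_c(G_i)`, `g_i ≥ 0`, `g_i(1) ≠ 0`
  have hex : ∀ i, ∃ g : C(G i, ℝ), HasCompactSupport g ∧ 0 ≤ (g : G i → ℝ) ∧ g 1 ≠ 0 := fun i =>
    exists_continuous_nonneg_pos (1 : G i)
  choose g hgs hg0 hg1 using hex
  set f : (∀ i, G i) → ℝ≥0∞ := fun x => ∏ i, ENNReal.ofReal (g i (x i)) with hf
  have hfm : Measurable f := Finset.measurable_prod _ fun i _ =>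
    ENNReal.measurable_ofReal.comp ((g i).continuous.measurable.comp (measurable_pi_apply i))
  -- the product of the integrals of the test functions
  set P : ℝ≥0∞ := ∏ i, ∫⁻ y, ENNReal.ofReal (g i y) ∂ν i with hP
  have hIi : ∀ i, ∫⁻ y, ENNReal.ofReal (g i y) ∂ν i = ENNReal.ofReal (∫ y, g i y ∂ν i) := fun i =>
    (ofReal_integral_eq_lintegral_ofReal ((g i).continuous.integrable_of_hasCompactSupport (hgs i))
      (Eventually.of_forall (hg0 i))).symm
  have hpi : ∀ i, 0 < ∫ y, g i y ∂ν i := fun i =>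
    (g i).continuous.integral_pos_of_hasCompactSupport_nonneg_nonzero (hgs i) (hg0 i) (hg1 i)
  have hPne : P ≠ 0 := Finset.prod_ne_zero_iff.2 fun i _ => by
    rw [hIi i]
    exact (ENNReal.ofReal_pos.2 (hpi i)).ne'
  have hPtop : P ≠ ∞ := ENNReal.prod_ne_top fun i _ => by
    rw [hIi i]
    exact ENNReal.ofReal_ne_top
  -- Weil's formula for `μ` on `f`, computed two ways
  have hweil := lintegral_fiberLIntegral_eq_mul_lintegral (Subgroup.pi Set.univ H) ρ μ (Measure.pi ν) hfm
  have hrhs : ∫⁻ x, f x ∂Measure.pi ν = P :=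
    lintegral_pi_prod_ofReal_eq_prod ν (fun i => (g i).continuous.integrable_of_hasCompactSupport (hgs i)) hg0
  have hlhs : ∫⁻ x, fiberLIntegral (Subgroup.pi Set.univ H) ρ f x ∂μ = P := by
    rw [hμ, ← Homeomorph.toMeasurableEquiv_coe, lintegral_map_equiv]
    -- pointwise: the fibre integral of `f` in product coordinates is the product of the fibre integrals
    have hpt : ∀ y : ∀ i, G i ⧸ H i,
        fiberLIntegral (Subgroup.pi Set.univ H) ρ f ((quotientPiHomeomorph H).symm.toMeasurableEquiv y) =
          ∏ i, ENNReal.ofReal (fiberIntegral (H i) (ρi i) (g i) (y i)) := by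
      intro y
      have hy : y = fun i => (QuotientGroup.mk (y i).out : G i ⧸ H i) := funext fun i => (QuotientGroup.out_eq' (y i)).symm
      rw [hy, Homeomorph.toMeasurableEquiv_coe, coe_quotientPiHomeomorph_symm, quotientPiEquiv_symm_mk,
        fiberLIntegral_pi_prod_eq H hH ρi ρ hρ (fun i => (g i).continuous) hgs hg0]
      exact Finset.prod_congr rfl fun i _ =>
        fiberLIntegral_ofReal_eq (H i) (ρi i) (g i).continuous (hgs i) (hg0 i) _
    simp_rw [hpt]
    rw [lintegral_pi_prod_ofReal_eq_prod q (φ := fun i => fiberIntegral (H i) (ρi i) (g i))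
      (fun i => (continuous_fiberIntegral (H i) (ρi i) (hH i) (g i).continuous (hgs i)).integrable_of_hasCompactSupport
        (hasCompactSupport_fiberIntegral (H i) (ρi i) (hH i) (hgs i)))
      (fun i => fiberIntegral_nonneg (H i) (ρi i) (hg0 i))]
    refine Finset.prod_congr rfl fun i _ => ?_
    -- `∫⁻ ofReal (g_i^{H_i}) d q_i = ∫⁻ (ofReal g_i)^{H_i} d q_i = ∫⁻ ofReal g_i d ν_i`
    have h2 : ∀ x, ENNReal.ofReal (fiberIntegral (H i) (ρi i) (g i) x) =
        fiberLIntegral (H i) (ρi i) (fun z => ENNReal.ofReal (g i z)) x := fun x => by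
      obtain ⟨z, rfl⟩ := QuotientGroup.mk_surjective x
      exact (fiberLIntegral_ofReal_eq (H i) (ρi i) (g i).continuous (hgs i) (hg0 i) z).symm
    simp_rw [h2]
    exact lintegral_fiberLIntegral_quotientMeasure (H i) (ρi i) (ν i)
      (ENNReal.measurable_ofReal.comp (g i).continuous.measurable)
  rw [hlhs, hrhs] at hweil
  have hc : unfoldingConstant (Subgroup.pi Set.univ H) ρ μ (Measure.pi ν) = 1 := by
    have h1 : (unfoldingConstant (Subgroup.pi Set.univ H) ρ μ (Measure.pi ν) : ℝ≥0∞) = 1 :=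
      (ENNReal.mul_left_inj hPne hPtop).1 (hweil.symm.trans (one_mul _).symm)
    exact_mod_cast h1
  rw [hμQ, hc, one_smul]

include hH hρ in
/-- The same read in product coordinates: `e_* ((⨂ ν_i)/(⨂ ρ_i)) = ⨂_i (ν_i/ρ_i)`.
[cite: Folland1995, §2.6 Thm. 2.49, (2.52)] -/
theorem map_quotientPiHomeomorph_quotientMeasure_pi :
    Measure.map (quotientPiHomeomorph H) (quotientMeasure (Subgroup.pi Set.univ H) ρ (isClosed_coe_pi H hH) (Measure.pi ν)) =
      Measure.pi fun i => quotientMeasure (H i) (ρi i) (hH i) (ν i) := by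
  rw [← map_quotientPiHomeomorph_symm_pi_quotientMeasure_eq H hH ρi ρ hρ ν,
    Measure.map_map (quotientPiHomeomorph H).measurable (quotientPiHomeomorph H).symm.measurable,
    Homeomorph.self_comp_symm, Measure.map_id]

include hH hρ in
/-- **Change of variables without constant**: `∫⁻ F d((⨂ν_i)/(⨂ρ_i)) = ∫⁻_{Π (G_i/H_i)} F((x_i)(Π H_i)) d(⨂ (ν_i/ρ_i))`
for measurable `F ≥ 0`. [cite: Folland1995, §2.6 Thm. 2.49, (2.52)] -/
theorem lintegral_quotientMeasure_pi_eq {F : (∀ i, G i) ⧸ Subgroup.pi Set.univ H → ℝ≥0∞} (hF : Measurable F) :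
    ∫⁻ x, F x ∂quotientMeasure (Subgroup.pi Set.univ H) ρ (isClosed_coe_pi H hH) (Measure.pi ν) =
      ∫⁻ p, F ((quotientPiHomeomorph H).symm p) ∂Measure.pi fun i => quotientMeasure (H i) (ρi i) (hH i) (ν i) := by
  rw [← map_quotientPiHomeomorph_symm_pi_quotientMeasure_eq H hH ρi ρ hρ ν,
    lintegral_map hF (quotientPiHomeomorph H).symm.measurable]

include hH hρ in
/-- **Product integrands factor exactly, `[0, ∞]`-valued form**: if `F((x_i)(Π H_i)) = Π_i f_i(x_i)` with
measurable `f_i ≥ 0` then `∫⁻ F d((⨂ν_i)/(⨂ρ_i)) = Π_i ∫⁻ f_i d(ν_i/ρ_i)`.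
[cite: Gelbart1975, p. 155 (10.19)] [cite: Folland1995, §2.6 (2.52)] -/
theorem lintegral_quotientMeasure_pi_prod_eq_prod {F : (∀ i, G i) ⧸ Subgroup.pi Set.univ H → ℝ≥0∞} (hF : Measurable F)
    {f : ∀ i, G i ⧸ H i → ℝ≥0∞} (hf : ∀ i, Measurable (f i))
    (hFf : ∀ p : ∀ i, G i ⧸ H i, F ((quotientPiHomeomorph H).symm p) = ∏ i, f i (p i)) :
    ∫⁻ x, F x ∂quotientMeasure (Subgroup.pi Set.univ H) ρ (isClosed_coe_pi H hH) (Measure.pi ν) =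
      ∏ i, ∫⁻ x, f i x ∂quotientMeasure (H i) (ρi i) (hH i) (ν i) := by
  haveI : ∀ i, IsClosed (H i : Set (G i)) := hH
  haveI : ∀ i, SecondCountableTopology (G i ⧸ H i) := fun i => inferInstance
  haveI : ∀ i, SigmaFinite (quotientMeasure (H i) (ρi i) (hH i) (ν i)) := fun i => inferInstance
  rw [lintegral_quotientMeasure_pi_eq H hH ρi ρ hρ ν hF]
  simp_rw [hFf]
  exact lintegral_fintype_prod_eq_prod _ hf

include hH hρ in
/-- **Bochner change of variables without constant**: `∫ F d((⨂ν_i)/(⨂ρ_i)) = ∫_{Π (G_i/H_i)} F((x_i)(Π H_i)) d(⨂ (ν_i/ρ_i))`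
for every Banach-valued `F`. [cite: Folland1995, §2.6 Thm. 2.49, (2.52)] -/
theorem integral_quotientMeasure_pi_eq_integral_pi {E : Type*} [NormedAddCommGroup E] [NormedSpace ℝ E]
    (F : (∀ i, G i) ⧸ Subgroup.pi Set.univ H → E) :
    ∫ x, F x ∂quotientMeasure (Subgroup.pi Set.univ H) ρ (isClosed_coe_pi H hH) (Measure.pi ν) =
      ∫ p, F ((quotientPiHomeomorph H).symm p) ∂Measure.pi fun i => quotientMeasure (H i) (ρi i) (hH i) (ν i) := by
  haveI : ∀ i, IsClosed (H i : Set (G i)) := hH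
  haveI : ∀ i, SecondCountableTopology (G i ⧸ H i) := fun i => inferInstance
  have h := integral_eq_smul_integral_pi H (fun i => quotientMeasure (H i) (ρi i) (hH i) (ν i))
    (ν := quotientMeasure (Subgroup.pi Set.univ H) ρ (isClosed_coe_pi H hH) (Measure.pi ν)) (c := 1)
    (by rw [one_smul, map_quotientPiHomeomorph_symm_pi_quotientMeasure_eq H hH ρi ρ hρ ν]) F
  rw [h, NNReal.coe_one, one_smul]

include hH hρ in
/-- **Product integrands factor exactly**: if `F((x_i)(Π H_i)) = Π_i f_i(x_i)` then
`∫ F d((⨂ν_i)/(⨂ρ_i)) = Π_i ∫ f_i d(ν_i/ρ_i)` — the normalised product `Π_{v ∈ S}` of Gelbart's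
(10.19) for product Haar measures. [cite: Gelbart1975, p. 155 (10.19)] [cite: Folland1995, §2.6 (2.52)] -/
theorem integral_quotientMeasure_pi_prod_eq_prod (F : (∀ i, G i) ⧸ Subgroup.pi Set.univ H → ℂ)
    (f : ∀ i, G i ⧸ H i → ℂ) (hF : ∀ p : ∀ i, G i ⧸ H i, F ((quotientPiHomeomorph H).symm p) = ∏ i, f i (p i)) :
    ∫ x, F x ∂quotientMeasure (Subgroup.pi Set.univ H) ρ (isClosed_coe_pi H hH) (Measure.pi ν) =
      ∏ i, ∫ x, f i x ∂quotientMeasure (H i) (ρi i) (hH i) (ν i) := by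
  haveI : ∀ i, IsClosed (H i : Set (G i)) := hH
  haveI : ∀ i, SecondCountableTopology (G i ⧸ H i) := fun i => inferInstance
  haveI : ∀ i, SigmaFinite (quotientMeasure (H i) (ρi i) (hH i) (ν i)) := fun i => inferInstance
  have h := integral_eq_smul_prod_integral H (fun i => quotientMeasure (H i) (ρi i) (hH i) (ν i))
    (ν := quotientMeasure (Subgroup.pi Set.univ H) ρ (isClosed_coe_pi H hH) (Measure.pi ν)) (c := 1)
    (by rw [one_smul, map_quotientPiHomeomorph_symm_pi_quotientMeasure_eq H hH ρi ρ hρ ν]) F f hF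
  rw [h, one_smul]

end PiNormalized

end Literature.MeasureTheory.Group
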